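import Summits.ResolutionOfSingularities.ResolutionOfSingularities.Theorems.PurelyInseparableDim4ScopeBlindSubstCert
import Summits.ResolutionOfSingularities.ResolutionOfSingularities.Theorems.PurelyInseparableDim4StepKitF4Lift
import Summits.ResolutionOfSingularities.ResolutionOfSingularities.Theorems.PurelyInseparableDim4ScopeDescent
import Summits.ResolutionOfSingularities.ResolutionOfSingularities.Theorems.PurelyInseparableDim4TrapBaseChange
import Mathlib.FieldTheory.IsAlgClosed.AlgebraicClosure
import Mathlib.Algebra.Polynomial.Degree.SmallDegree
import Mathlib.Algebra.CharP.Two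
import HarnessLib

/-!
# UNIFORM-OUT on a pair of `𝔽₄`-CONJUGATE PLANES — the «norm leaf» of the ∀K column ‖ K

Census cell «res-dim4-pi» (D-0157 DOOR 2), seat res-dim4-p-8 g3 (finite-field kernel lane), for res-dim4-typ-3g9's FCert v2 and
res-dim4-eng-w2's witness inventory: 35 of the 162 «uniform-out» loci of the (2,2) ∀K residue are PAIRS OF PLANES CONJUGATE OVER
`𝔽₄`, `{x_T = 0, x_u = ω x_v} ∪ {x_T = 0, x_u = ω² x_v}`, visible over `𝔽₂` only through their product, the norm form
`x_u² + x_u x_v + x_v²`.  A row checker over `𝔽₂` cannot name `ω`; this file removes the need: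

* §1 `normSigma T u v : Fin 4 → Terms 4 F4` — the substitution `x_T ↦ 0, x_u ↦ ω·x_v, xᵢ ↦ xᵢ` over res-dim4-p-4's computable
  `StepKit.F4`, and `map_evalT_single` (its entries read in any field along a ring map);
* §2 **`plane_blind_of_root`**: ONE certificate `substBlindB 2 (chartL 2 S j s₀.castF4.L) (normSigma T u v) T α₀ = true`
  (this seat's `…ScopeBlindSubstCert`, by `decide` over `F4`) gives, for every field `K'` of characteristic `2` holding a root `β`
  of `X² + X + 1` and every `b'` with `b'_T = 0`, `b'_u = β b'_v`, that the child `CentreBlowup.step 2 S j b' (s₀ ⊗ K')` is OUT of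
  coordinate scope (transport along `F4.lift β`, `…StepKitF4Lift`);
* §3 **`normLeaf_children_blind`** — the σ-free form: for EVERY field `K` of characteristic `2` (with or without `ω`) and EVERY
  `b ∈ K⁴` with `b_T = 0` and `b_u² + b_u b_v + b_v² = 0`, the child at `b` is out of coordinate scope.  Proof: pass to
  `AlgebraicClosure K`, pick a root `β` (`IsAlgClosed.exists_root`), factor the norm form as `(b_u + β b_v)(b_u + β² b_v)`, apply §2
  with `β` or `β²` (`F4.root_sq`), and DESCEND with res-dim4-p-14's `BaseChange.step_map` + `ScopeDescent.inCoordinateScope_map_iff`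
  (coordinate scope is geometric);
* §4 the 𝔽₂-side name **`normLeafB s₀ S j T u v α₀ : Bool`** with soundness **`children_blind_of_normLeafB`** (the interface for
  typ-3's row checker: in a Nullstellensatz cover the pair contributes the single factor `x_u² + x_u x_v + x_v²`);
* §5 acceptance on a real row of eng-w2's list: root S1a-529c38e89e `x₃³ + x₄³`, point centre, chart `x₁`, child
  `x₁(x₃ + x₄)(x₃² + x₃x₄ + x₄²)`: `normLeafB_cubePair` by `decide` and **`cubePair_children_blind`** (∀ K ∀ b, `b₁ = 0`,
  `b₃² + b₃b₄ + b₄² = 0`).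

Honest scope: a sufficient criterion for ONE child of OUR frame's centre blow-up to be out of coordinate scope, uniformly in the
field and in the point of a conjugate-plane pair; nothing here proves F4-C(2,2), `TerminatesInScope 2 2`, or resolution of
singularities in dimension ≥ 4 / characteristic p.  [OURS · counted 0 · kernel work, weaker than expert review.]
bears_on: LADDER-RESOLUTION:D157-DOOR2 (res-dim4-pi · ∀K column · norm leaf).  Supports stmt-ResolutionOfSingularities-16155 (helper).
-/

set_option linter.dupNamespace false -- mandated namespace of this single-conjunct summit

noncomputable section

open MvPolynomial Finset
open scoped BigOperators

namespace Summit.ResolutionOfSingularities.ResolutionOfSingularities.Theorems.PIDim4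

namespace ScopeBlind

open Literature.AlgebraicGeometry.Resolution
open Literature.AlgebraicGeometry.Resolution.CentreBlowup
open Literature.AlgebraicGeometry.Resolution.Hauser2010
open StepKit ScopeCover ScopeDynamics

/-! ## §1 The substitution of a conjugate plane -/

/-- **`normSigma T u v`**: `xᵢ ↦ 0` for `i ∈ T`, `x_u ↦ ω · x_v`, `xᵢ ↦ xᵢ` otherwise — the plane `{x_T = 0, x_u = ω x_v}` over
`F4` as a fixed substitution. [OURS · instrument] -/
def normSigma (T : Finset (Fin 4)) (u v : Fin 4) : Fin 4 → Terms 4 F4 := fun i =>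
  if i ∈ T then [] else if i = u then [((Pi.single v 1 : Fin 4 → ℕ), F4.om)] else [((Pi.single i 1 : Fin 4 → ℕ), 1)]

/-- the exponent vector of a single variable. [folklore] -/
theorem expo_pi_single (v : Fin 4) : expo (Pi.single v 1 : Fin 4 → ℕ) = Finsupp.single v 1 := by
  ext i
  rw [expo_apply, Finsupp.single_eq_pi_single]

/-- a one-term list `c · x_v` read in `K` along `f`: `C (f c) * X v`. [folklore] -/
theorem map_evalT_single {K : Type} [Field K] (f : F4 →+* K) (v : Fin 4) (c : F4) :
    MvPolynomial.map f (evalT [((Pi.single v 1 : Fin 4 → ℕ), c)]) = C (f c) * X v := by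
  rw [evalT_cons, evalT_nil, add_zero, map_monomial, expo_pi_single, C_mul_X_eq_monomial]

/-! ## §2 One plane, over a field that has `ω` -/

/-- **ONE CONJUGATE PLANE.**  If the `F4`-certificate of the plane `{x_T = 0, x_u = ω x_v}` checks, then over every field `K'` of
characteristic `2` with a root `β` of `X² + X + 1`, at every `b'` with `b'_T = 0` and `b'_u = β·b'_v`, the child of the `𝔽₂`-state
`s₀` (read in `K'`) under the blow-up of `V(z, x_S)` in the chart `x_j` is OUT of coordinate scope. [OURS · ‖ K] -/
theorem plane_blind_of_root {s₀ : SData 4 (ZMod 2)} {S : Finset (Fin 4)} {j : Fin 4} {T : Finset (Fin 4)} {u v : Fin 4}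
    {α₀ : Fin 4 → ℕ} (h : substBlindB 2 (chartL 2 S j s₀.castF4.L) (normSigma T u v) T α₀ = true)
    (K' : Type) [Field K'] [CharP K' 2] [DecidableEq K'] (β : K') (hβ : β ^ 2 + β + 1 = 0) (b' : Fin 4 → K')
    (hT : ∀ i ∈ T, b' i = 0) (hu : b' u = β * b' v) :
    ¬ InCoordinateScope 2
      (CentreBlowup.step 2 S j b'
        (⟨MvPolynomial.map (ZMod.castHom (dvd_refl 2) K') s₀.toState.F, s₀.toState.r, s₀.toState.exc⟩ : State K')).F := by
  rw [SData.map_castHom_eq_map_lift_castF4 s₀ β hβ]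
  refine not_inCoordinateScope_step_map_of_substBlindB h K' (F4.lift β hβ) b' fun i => ?_
  unfold normSigma
  by_cases hiT : i ∈ T
  · rw [if_pos hiT, evalT_nil, map_zero, map_zero, hT i hiT]
  · by_cases hiu : i = u
    · rw [if_neg hiT, if_pos hiu, map_evalT_single, map_mul, eval_C, eval_X, F4.lift_om, hiu, hu]
    · rw [if_neg hiT, if_neg hiu, map_evalT_single, map_one, C_1, one_mul, eval_X]

/-! ## §3 The σ-free statement over EVERY field of characteristic `2` -/

/-- in characteristic `2`, `x + y = 0` means `x = y`. [folklore] -/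
theorem eq_of_add_eq_zero_charTwo {R : Type} [Ring R] [CharP R 2] {x y : R} (h : x + y = 0) : x = y := by
  rw [← CharTwo.sub_eq_add] at h
  exact sub_eq_zero.mp h

/-- every algebraically closed field of characteristic `2` has a root of `X² + X + 1`. [folklore] -/
theorem exists_root_cyclotomic3 (K' : Type) [Field K'] [IsAlgClosed K'] : ∃ β : K', β ^ 2 + β + 1 = 0 := by
  obtain ⟨x, hx⟩ := IsAlgClosed.exists_root
    (Polynomial.C 1 * Polynomial.X ^ 2 + Polynomial.C 1 * Polynomial.X + Polynomial.C 1 : Polynomial K')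
    (by rw [Polynomial.degree_quadratic one_ne_zero]; decide)
  exact ⟨x, by simpa using hx⟩

/-- the norm form factors over a root `β` of `X² + X + 1` (characteristic `2`):
`(U + βV)(U + β²V) = U² + UV + V²`. [folklore] -/
theorem norm_factor {R : Type} [CommRing R] [CharP R 2] (β U V : R) (hβ : β ^ 2 + β + 1 = 0) :
    (U + β * V) * (U + β ^ 2 * V) = U ^ 2 + U * V + V ^ 2 := by
  linear_combination (-(U * V)) * (CharTwo.two_eq_zero (R := R)) + ((β - 1) * V ^ 2 + U * V) * hβ

/-- **THE NORM LEAF.**  If the `F4`-certificate of the plane `{x_T = 0, x_u = ω x_v}` checks for the `𝔽₂`-state `s₀` (blow-up of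
`V(z, x_S)`, chart `x_j`), then for EVERY field `K` of characteristic `2` and EVERY `b ∈ K⁴` with `b_T = 0` and
`b_u² + b_u b_v + b_v² = 0` the child `CentreBlowup.step 2 S j b (s₀ ⊗ K)` is OUT of coordinate scope — both conjugate planes at
once, and also the fields without `ω` (where the norm form has only the points `b_u = b_v = 0`). [OURS · ‖ K] -/
theorem normLeaf_children_blind {s₀ : SData 4 (ZMod 2)} {S : Finset (Fin 4)} {j : Fin 4} {T : Finset (Fin 4)} {u v : Fin 4}
    {α₀ : Fin 4 → ℕ} (h : substBlindB 2 (chartL 2 S j s₀.castF4.L) (normSigma T u v) T α₀ = true)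
    (K : Type) [Field K] [CharP K 2] [DecidableEq K] (b : Fin 4 → K) (hT : ∀ i ∈ T, b i = 0)
    (hQ : b u ^ 2 + b u * b v + b v ^ 2 = 0) :
    ¬ InCoordinateScope 2
      (CentreBlowup.step 2 S j b
        (⟨MvPolynomial.map (ZMod.castHom (dvd_refl 2) K) s₀.toState.F, s₀.toState.r, s₀.toState.exc⟩ : State K)).F := by
  classical
  intro hsc
  let Kb : Type := AlgebraicClosure K
  let g : K →+* Kb := algebraMap K Kb
  -- (a) the child read in `Kb` is the child of the `Kb`-state at `g ∘ b`, and it is in scope there as well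
  have key : InCoordinateScope 2
      (CentreBlowup.step 2 S j (⇑g ∘ b)
        (⟨MvPolynomial.map (ZMod.castHom (dvd_refl 2) Kb) s₀.toState.F, s₀.toState.r, s₀.toState.exc⟩ : State Kb)).F := by
    have e3 : MvPolynomial.map g (MvPolynomial.map (ZMod.castHom (dvd_refl 2) K) s₀.toState.F) =
        MvPolynomial.map (ZMod.castHom (dvd_refl 2) Kb) s₀.toState.F := by
      rw [MvPolynomial.map_map,
        show g.comp (ZMod.castHom (dvd_refl 2) K) = ZMod.castHom (dvd_refl 2) Kb from Subsingleton.elim _ _]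
    have e2 : (CentreBlowup.step 2 S j (⇑g ∘ b)
        (⟨MvPolynomial.map g (MvPolynomial.map (ZMod.castHom (dvd_refl 2) K) s₀.toState.F), s₀.toState.r, s₀.toState.exc⟩ :
          State Kb)).F =
        MvPolynomial.map g (CentreBlowup.step 2 S j b
          (⟨MvPolynomial.map (ZMod.castHom (dvd_refl 2) K) s₀.toState.F, s₀.toState.r, s₀.toState.exc⟩ : State K)).F := by
      rw [BaseChange.step_map g 2 S j b
        (⟨MvPolynomial.map (ZMod.castHom (dvd_refl 2) K) s₀.toState.F, s₀.toState.r, s₀.toState.exc⟩ : State K)]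
    rw [e3] at e2
    rw [e2]
    exact (ScopeDescent.inCoordinateScope_map_iff g).2 hsc
  -- (b) a root `β` of `X² + X + 1` in `Kb` and the factorisation of the norm form at `g ∘ b`
  obtain ⟨β, hβ⟩ := exists_root_cyclotomic3 Kb
  have hQ' : g (b u) ^ 2 + g (b u) * g (b v) + g (b v) ^ 2 = 0 := by simpa using congrArg g hQ
  have hfac : (g (b u) + β * g (b v)) * (g (b u) + β ^ 2 * g (b v)) = 0 := by rw [norm_factor β _ _ hβ, hQ']
  have hTb : ∀ i ∈ T, (⇑g ∘ b) i = 0 := fun i hi => by rw [Function.comp_apply, hT i hi, map_zero]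
  -- (c) `g ∘ b` lies on one of the two conjugate planes; either way §2 applies (with `β` or with `β²`)
  rcases mul_eq_zero.mp hfac with h1 | h1
  · exact plane_blind_of_root h Kb β hβ (⇑g ∘ b) hTb (eq_of_add_eq_zero_charTwo h1) key
  · exact plane_blind_of_root h Kb (β ^ 2) (F4.root_sq β hβ) (⇑g ∘ b) hTb (eq_of_add_eq_zero_charTwo h1) key

/-! ## §4 The `𝔽₂`-side certificate name -/

/-- **`normLeafB s₀ S j T u v α₀`** — the norm-leaf certificate of an `𝔽₂`-presented state: the substitution certificate of ONE of
the two conjugate planes, computed over `F4` (decidable; `decide`). [OURS · instrument] -/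
def normLeafB (s₀ : SData 4 (ZMod 2)) (S : Finset (Fin 4)) (j : Fin 4) (T : Finset (Fin 4)) (u v : Fin 4)
    (α₀ : Fin 4 → ℕ) : Bool :=
  substBlindB 2 (chartL 2 S j s₀.castF4.L) (normSigma T u v) T α₀

/-- **SOUNDNESS of `normLeafB`** (the interface): `normLeafB s₀ S j T u v α₀ = true` ⟹ for every field `K` of characteristic `2`
and every `b` with `b_T = 0`, `b_u² + b_u b_v + b_v² = 0`, the child `CentreBlowup.step 2 S j b (s₀ ⊗ K)` is out of coordinate
scope. [OURS · ‖ K] -/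
theorem children_blind_of_normLeafB {s₀ : SData 4 (ZMod 2)} {S : Finset (Fin 4)} {j : Fin 4} {T : Finset (Fin 4)}
    {u v : Fin 4} {α₀ : Fin 4 → ℕ} (h : normLeafB s₀ S j T u v α₀ = true)
    (K : Type) [Field K] [CharP K 2] [DecidableEq K] (b : Fin 4 → K) (hT : ∀ i ∈ T, b i = 0)
    (hQ : b u ^ 2 + b u * b v + b v ^ 2 = 0) :
    ¬ InCoordinateScope 2
      (CentreBlowup.step 2 S j b
        (⟨MvPolynomial.map (ZMod.castHom (dvd_refl 2) K) s₀.toState.F, s₀.toState.r, s₀.toState.exc⟩ : State K)).F :=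
  normLeaf_children_blind h K b hT hQ

/-! ## §5 Acceptance: eng-w2's row S1a-529c38e89e (`x₃³ + x₄³`, point centre, chart `x₁`) -/

/-- the root `x₃³ + x₄³` over `𝔽₂` (`r = 0`, `exc = ∅`); its `x₁`-chart child under the point blow-up is
`x₁(x₃³ + x₄³) = x₁ (x₃ + x₄) (x₃² + x₃x₄ + x₄²)`, whose 2-fold locus on `E = {x₁ = 0}` is the plane `x₃ = x₄` together with the
conjugate pair `x₃ = ω x₄`, `x₃ = ω² x₄`. [OURS · specimen] -/
def cubePairSpec : SData 4 (ZMod 2) := ⟨[(![0, 0, 3, 0], 1), (![0, 0, 0, 3], 1)], ![0, 0, 0, 0], ∅⟩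

/-- the norm-leaf certificate of the conjugate pair (`T = {x₁}`, `u = x₃`, `v = x₄`, `α₀ = e₁`) checks, by `decide` over `F4`.
[OURS · ‖ K] -/
theorem normLeafB_cubePair : normLeafB cubePairSpec Finset.univ 0 {0} 2 3 ![1, 0, 0, 0] = true := by
  decide

/-- **hence over EVERY field `K` of characteristic `2`, at EVERY point `b` of the exceptional divisor with
`b₃² + b₃ b₄ + b₄² = 0`, the child of `x₃³ + x₄³` (point blow-up, chart `x₁`) is OUT of coordinate scope.** [OURS · ‖ K] -/
theorem cubePair_children_blind (K : Type) [Field K] [CharP K 2] [DecidableEq K] (b : Fin 4 → K) (hb1 : b 0 = 0)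
    (hQ : b 2 ^ 2 + b 2 * b 3 + b 3 ^ 2 = 0) :
    ¬ InCoordinateScope 2
      (CentreBlowup.step 2 Finset.univ 0 b
        (⟨MvPolynomial.map (ZMod.castHom (dvd_refl 2) K) cubePairSpec.toState.F, cubePairSpec.toState.r,
          cubePairSpec.toState.exc⟩ : State K)).F :=
  children_blind_of_normLeafB normLeafB_cubePair K b (fun i hi => by rw [Finset.mem_singleton] at hi; rw [hi, hb1]) hQ

end ScopeBlind

end Summit.ResolutionOfSingularities.ResolutionOfSingularities.Theorems.PIDim4

end
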